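import Summits.CriticalPhenomena.PercolationContinuityZ3.Theorems.PercNearOneGluingNoHeavyQuantLowToZeroMove
import HarnessLib

/-!
# QUANT lane R8, T-DEC, leg (III): the blob gate move (M) from a flow DATUM with a dichotomy — no hypothesis on the unshifted
# atoms below the blob (typer g28, part 2 of 2)

builds on p205010 (kernel theorem, internal audit signed; external expert review pending)

Support file (`--supports stmt-CriticalPhenomena-4575`), QUANT lane typer seat prim-quant-stmt (gen 28), rung R8 of
`run/shared/lean/prim/quant/LADDER.md`.  Theorems only, standard axioms, no sorries, no definitions.  Part 1: `…QuantLowToZeroMove`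
(the two datum-form criteria `flowAtT_lowToZero_of_giantBound` / `flowAtT_lowToZero_of_midAbsorbed` for an arbitrary law).

* **`LawDec.flowAtT_gateMoveBlob_of_datum`** — the setting of typer g27's `flowAtT_gateMoveBlob` (`0 < y < 1`, `0 ≤ z ≤ ν 0`, `g ≤ 1`,
  `y ≤ (1−z)g`, `1 ≤ a`, `ν` a probability law on `{0..M}` of mean `S ≥ yM`) with the blob atom `a` a low of the new target
  (`a ≤ j < M + a`, `2a < t = S + ag − zag`) and WITHOUT `hsupp`: if `slice ν a g` has a flow datum `f` at `(y, S + ag, j)` such that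
  either `f` ships `≥ gz` of the atom `a` to the giants, or every nonzero `t`-low `≠ a` ships nothing to the giants, then
  `slice ν a g + gz(δ₀ − δ_a) ∈ FlowAtT(y, t, j)`.  **`LawDec.decAtT_gateMoveBlob_of_datum`** — the DEC form.
WHICH DATA SATISFY THE DICHOTOMY (memo `run/shared/lean/prim/quant/prim-quant-stmt-g28/GATE-MOVE-G28.md`): the CORNER datum of
`…QuantCornerRun` (lows processed downwards, each into its compatible mids upwards, leftovers to the giants) has the threshold
structure "once a low keeps a leftover, every smaller low is entirely giant-bound"; so if any low above `a` keeps a leftover the first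
branch holds (`a` is entirely giant-bound and `slice ν a g a ≥ g·ν 0 ≥ gz`), and otherwise the second branch holds as soon as no
UNSHIFTED atom strictly between `0` and `a` keeps a leftover — in particular for `a = 1` and under `hsupp` (typer g27's cases), but also
for every `ν` whose atoms below `a` are mid-absorbed by the corner run.  The remaining configuration (an unshifted atom `0 < k < a`
giant-bound while `a` is not) is sub-case (b′) of the memo: the corner-datum construction still succeeds in every exact test
(0 / ≈ 40 000, adversarial hill-climbs included) but its inequality is not proved.  HONEST STATUS: (M) for general `a`, `GateMove`,
`GatedConvEmptyFree`, `SingleGateConvClosed`, `SDECConvClosed`, `TreeDEC`, `FarTreeRow` remain OPEN.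

[this work]; (M) and its `hsupp` proof: typer g27; corner run: typer g23 / lead g21 (this lane).  The gluing rows served
[cite: KozmaNitzan2024, Conjecture 3 (p. 15)]; product measure [cite: Grimmett1999, §1.3 p. 10].
-/

noncomputable section

namespace Summit.CriticalPhenomena.PercolationContinuityZ3.Theorems

namespace Quant

open Finset

namespace LawDec

/-! ### The blob gate move (M) from a datum, without `hsupp` -/

/-- **THE BLOB GATE MOVE FROM A DATUM (flow form, `a` a `t`-low), no hypothesis on the atoms below the blob.**  Setting of
`flowAtT_gateMoveBlob` (typer g27) WITHOUT `hsupp`: `0 < y < 1`, `0 ≤ z ≤ ν 0`, `g ≤ 1`, `y ≤ (1−z)g`, `1 ≤ a ≤ j < M + a`, `ν` a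
probability law on `{0..M}` of mean `S ≥ y·M`, `2a < t := S + ag − zag`.  If `slice ν a g` has a flow datum `f` at `(y, S + ag, j)`
such that EITHER `f` ships at least `gz` of the atom `a` to the giants OR every nonzero `t`-low other than `a` ships nothing to
the giants, then the moved law `slice ν a g + gz(δ₀ − δ_a)` has a flow at `(y, t, j)`.  (With the corner datum the dichotomy holds
unless an unshifted atom strictly between `0` and `a` is giant-bound while `a` is not — memo GATE-MOVE-G28.) [this work] -/
theorem flowAtT_gateMoveBlob_of_datum (y z g S : ℝ) (a j M : ℕ) (ν : ℕ → ℝ) (f : ℕ → ℕ → ℝ)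
    (hy0 : 0 < y) (hy1 : y < 1) (hz0 : 0 ≤ z) (hg1 : g ≤ 1) (hyg : y ≤ (1 - z) * g) (ha : 1 ≤ a)
    (hν0 : ∀ h, 0 ≤ ν h) (hνM : ∀ h, M < h → ν h = 0) (hν1 : ∑ h ∈ Finset.range (M + 1), ν h = 1)
    (hS : S = ∑ h ∈ Finset.range (M + 1), (h : ℝ) * ν h) (hta : y * (M : ℝ) ≤ S) (hzν : z ≤ ν 0)
    (hjN : j < M + a) (haj : a ≤ j) (hat : 2 * (a : ℝ) < S + (a : ℝ) * g - z * (a : ℝ) * g)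
    (hf : IsFlowAtT y (S + (a : ℝ) * g) j (M + a) (slice ν a g) f)
    (hdatum : g * z ≤ ∑ h ∈ Finset.Ico (j + 1) (M + a + 1), f a h ∨
      ∀ l h, 1 ≤ l → l ≠ a → l ≤ j → 2 * (l : ℝ) < S + (a : ℝ) * g - z * (a : ℝ) * g → j + 1 ≤ h → f l h = 0) :
    FlowAtT y (S + (a : ℝ) * g - z * (a : ℝ) * g) j (M + a)
      (fun h => slice ν a g h + g * z * ((if h = 0 then (1 : ℝ) else 0) - (if h = a then (1 : ℝ) else 0))) := by
  set τ : ℝ := S + (a : ℝ) * g with hτ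
  set t : ℝ := S + (a : ℝ) * g - z * (a : ℝ) * g with ht
  have hz1 : z ≤ 1 := by
    have h0 := Finset.single_le_sum (fun h _ => hν0 h) (Finset.mem_range.2 (Nat.succ_pos M))
    rw [hν1] at h0
    exact hzν.trans h0
  have hg0 : 0 < g := by
    by_contra hc
    have : (1 - z) * g ≤ 0 := mul_nonpos_of_nonneg_of_nonpos (by linarith) (not_lt.1 hc)
    linarith
  have ha0 : (0 : ℝ) < a := by exact_mod_cast ha
  have hzag : 0 ≤ z * (a : ℝ) * g := mul_nonneg (mul_nonneg hz0 ha0.le) hg0.le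
  have htτ : t ≤ τ := by rw [ht, hτ]; linarith
  have htaN : y * ((M + a : ℕ) : ℝ) ≤ t := by
    rw [ht]; push_cast
    have : y * (a : ℝ) ≤ (1 - z) * g * a := mul_le_mul_of_nonneg_right hyg ha0.le
    nlinarith
  obtain ⟨hP0, hPM, hP1, hPt⟩ := moved_laws ν a M g z ha hg0.le hg1 hz0 hzν hν0 hνM hν1
  have hPt' : ∑ h ∈ Finset.range (M + a + 1),
      (h : ℝ) * (slice ν a g h + g * z * ((if h = 0 then (1 : ℝ) else 0) - (if h = a then (1 : ℝ) else 0))) = t := by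
    rw [hPt, ← hS, ht]
  have hΛ0 : ∀ h, 0 ≤ slice ν a g h := fun h => slice_nonneg ν a g hg0.le hg1 hν0 h
  have hgzΛa : g * z ≤ slice ν a g a := by
    rw [slice_apply_self]; nlinarith [hν0 a, mul_le_mul_of_nonneg_left hzν hg0.le]
  by_cases hGa : g * z ≤ ∑ h ∈ Finset.Ico (j + 1) (M + a + 1), f a h
  · exact flowAtT_lowToZero_of_giantBound y τ t (g * z) a j (M + a) (slice ν a g) f hy0 hy1 htτ
      (mul_nonneg hg0.le hz0) haj hat hΛ0 hf hGa
  · have habs := hdatum.resolve_left hGa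
    exact flowAtT_lowToZero_of_midAbsorbed y τ t (g * z) a j (M + a) (slice ν a g) f hy0 hy1 htτ haj hat hjN hf
      hgzΛa hP0 hP1 hPt' htaN (not_le.1 hGa).le habs

/-- **THE BLOB GATE MOVE FROM A DATUM, DEC form.**  As `flowAtT_gateMoveBlob_of_datum`, concluding
`DECAtT y (S + ag − zag) j (M+a)` of the moved law. [this work] -/
theorem decAtT_gateMoveBlob_of_datum (y z g S : ℝ) (a j M : ℕ) (ν : ℕ → ℝ) (f : ℕ → ℕ → ℝ)
    (hy0 : 0 < y) (hy1 : y < 1) (hz0 : 0 ≤ z) (hg1 : g ≤ 1) (hyg : y ≤ (1 - z) * g) (ha : 1 ≤ a)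
    (hν0 : ∀ h, 0 ≤ ν h) (hνM : ∀ h, M < h → ν h = 0) (hν1 : ∑ h ∈ Finset.range (M + 1), ν h = 1)
    (hS : S = ∑ h ∈ Finset.range (M + 1), (h : ℝ) * ν h) (hta : y * (M : ℝ) ≤ S) (hzν : z ≤ ν 0)
    (hjN : j < M + a) (haj : a ≤ j) (hat : 2 * (a : ℝ) < S + (a : ℝ) * g - z * (a : ℝ) * g)
    (hf : IsFlowAtT y (S + (a : ℝ) * g) j (M + a) (slice ν a g) f)
    (hdatum : g * z ≤ ∑ h ∈ Finset.Ico (j + 1) (M + a + 1), f a h ∨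
      ∀ l h, 1 ≤ l → l ≠ a → l ≤ j → 2 * (l : ℝ) < S + (a : ℝ) * g - z * (a : ℝ) * g → j + 1 ≤ h → f l h = 0) :
    DECAtT y (S + (a : ℝ) * g - z * (a : ℝ) * g) j (M + a)
      (fun h => slice ν a g h + g * z * ((if h = 0 then (1 : ℝ) else 0) - (if h = a then (1 : ℝ) else 0))) := by
  have hg0 : 0 < g := by
    have hz1 : z ≤ 1 := by
      have h0 := Finset.single_le_sum (fun h _ => hν0 h) (Finset.mem_range.2 (Nat.succ_pos M))
      rw [hν1] at h0
      exact hzν.trans h0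
    by_contra hc
    have : (1 - z) * g ≤ 0 := mul_nonpos_of_nonneg_of_nonpos (by linarith) (not_lt.1 hc)
    linarith
  obtain ⟨_, hPM, hP1, _⟩ := moved_laws ν a M g z ha hg0.le hg1 hz0 hzν hν0 hνM hν1
  exact decAtT_of_flowAtT y _ j (M + a) _ hy0 hy1 hPM hP1
    (flowAtT_gateMoveBlob_of_datum y z g S a j M ν f hy0 hy1 hz0 hg1 hyg ha hν0 hνM hν1 hS hta hzν hjN haj hat hf hdatum)

end LawDec

end Quant

end Summit.CriticalPhenomena.PercolationContinuityZ3.Theorems
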